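import Mathlib
import HarnessLib
import Summits.NavierStokesRegularity.NavierStokesRegularity.Theorems.PoloidalWindowDoorLrcModEntireTHCertCancel

/-!
# Route `PoloidalWindowDoor`, item `LrcModEntire` (stmt-NavierStokesRegularity-20428) — the (TH) local datum WITH HAND-PROVED EXTRA LAWS AND PINS
# (hybrid road: human integrability laws + machine certificate)

Cell ns-regularity-ideate, seat ns-poloidal-K2-p3 gen 7 (lead of item 20428; `--supports stmt-NavierStokesRegularity-20428`).
`…THCertFast.thLocalDatum` packs the registered stub's analytic data into a `LocalDatum` with hypothesis laws `thHyps L` (poloidal, div, shear₀,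
shear₁, E) and pins `thPins L` (twist, μ, μ−1, μ_z).  If a human (the interim K2 lead's «first integrability law as a tree lemma on the datum»,
K2-p2 g7 23:11Z; cert-1's closed-form `L₆`) PROVES further polynomial laws `T` on `U` — `∀ p ∈ U, ev T (jetMapOf L u μ A p) = 0`, stated through
the dictionary `…THCert.ev_V` / `…THCertDictionary.letterFn_*` — or further pins at `p₀`, they enter the datum here, and the engine's certificate may
START from them (shortcutting the prolongation orders a machine would need to re-derive them):

* `thLocalDatum_with` — `LocalDatum … (thHyps L ++ extra) (thPins L ++ pinsX)` from the stub's data plus the extra laws / pins;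
* `false_of_checkTreeC_with` / `false_of_checkTreeS_with` — a checked tree (with / without cancellation nodes) against `thHyps L ++ extra ++ Ts` and
  `thPins L ++ pinsX` closes the goal, after the usual chunk folding (`localDatum_extendS`, `localDatum_cancelS`).

WHAT THIS IS NOT: not a claim about Navier–Stokes and not a certificate — plumbing for the hybrid road. [folklore]
-/

noncomputable section

-- the summit and its single sub-problem share the name (CONVENTIONS §1), as in every Theorems file
set_option linter.dupNamespace false

namespace Summit.NavierStokesRegularity.NavierStokesRegularity.Theorems.PoloidalWindowDoorLrcModEntireTHCertExtra

open _root_.Topology _root_.Filter Set Function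
open scoped InnerProductSpace Laplacian
open Literature.Analysis.ValidatedNumerics
open Summit.NavierStokesRegularity.NavierStokesRegularity.Theorems.PoloidalWindowDoorLrcModEntireJetCertDefs
open Summit.NavierStokesRegularity.NavierStokesRegularity.Theorems.PoloidalWindowDoorLrcModEntireJetCertTree
open Summit.NavierStokesRegularity.NavierStokesRegularity.Theorems.PoloidalWindowDoorLrcModEntireJetCertFast2
open Summit.NavierStokesRegularity.NavierStokesRegularity.Theorems.PoloidalWindowDoorLrcModEntireJetCertCancel
open Summit.NavierStokesRegularity.NavierStokesRegularity.Theorems.PoloidalWindowDoorLrcModEntireTHCertLetters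
open Summit.NavierStokesRegularity.NavierStokesRegularity.Theorems.PoloidalWindowDoorLrcModEntireTHCert
open Summit.NavierStokesRegularity.NavierStokesRegularity.Theorems.PoloidalWindowDoorLrcModEntireTHCertFast

/-- **The (TH) local datum with hand-proved extra laws on `U` and extra pins at `p₀`.** [folklore] -/
theorem thLocalDatum_with (L : List THLetter) (hL : lettersOK L = true)
    {u : ℝ → EuclideanSpace ℝ (Fin 3) → EuclideanSpace ℝ (Fin 3)} {μ A : ℝ → ℝ → ℝ}
    {U : Set (ℝ × EuclideanSpace ℝ (Fin 3))} {p₀ : ℝ × EuclideanSpace ℝ (Fin 3)} (hU : IsOpen U) (hp₀ : p₀ ∈ U)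
    (hu : AnalyticOnNhd ℝ (Function.uncurry u) U)
    (hμ : ∀ p ∈ U, AnalyticAt ℝ (Function.uncurry μ) (p.1, p.2 2)) (hA : ∀ p ∈ U, AnalyticAt ℝ (Function.uncurry A) (p.1, p.2 2))
    (hpol : ∀ p ∈ U, fderiv ℝ (u p.1) p.2 (EuclideanSpace.single 0 1) 1 = fderiv ℝ (u p.1) p.2 (EuclideanSpace.single 1 1) 0)
    (hdiv : ∀ p ∈ U, fderiv ℝ (u p.1) p.2 (EuclideanSpace.single 0 1) 0 + fderiv ℝ (u p.1) p.2 (EuclideanSpace.single 1 1) 1 +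
      fderiv ℝ (u p.1) p.2 (EuclideanSpace.single 2 1) 2 = 0)
    (hsh : ∀ p ∈ U, ∀ b : Fin 3, b ≠ 2 →
      fderiv ℝ (u p.1) p.2 (EuclideanSpace.single 2 1) b = μ p.1 (p.2 2) * fderiv ℝ (u p.1) p.2 (EuclideanSpace.single b 1) 2)
    (hE : ∀ p ∈ U,
      (1 - μ p.1 (p.2 2)) *
          (deriv (fun s => u s p.2 2) p.1 + fderiv ℝ (fun y => u p.1 y 2) p.2 (u p.1 p.2) - Δ (fun y => u p.1 y 2) p.2) =
        A p.1 (p.2 2) + (deriv (fun s => μ s (p.2 2)) p.1 - deriv (deriv (μ p.1)) (p.2 2)) * u p.1 p.2 2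
          + deriv (μ p.1) (p.2 2) / 2 * u p.1 p.2 2 ^ 2 - 2 * deriv (μ p.1) (p.2 2) * fderiv ℝ (u p.1) p.2 (EuclideanSpace.single 2 1) 2)
    (htw : fderiv ℝ (fun y => fderiv ℝ (u p₀.1) y (EuclideanSpace.single 2 1) 2) p₀.2 (EuclideanSpace.single 0 1) *
            fderiv ℝ (u p₀.1) p₀.2 (EuclideanSpace.single 1 1) 2 -
          fderiv ℝ (fun y => fderiv ℝ (u p₀.1) y (EuclideanSpace.single 2 1) 2) p₀.2 (EuclideanSpace.single 1 1) *
            fderiv ℝ (u p₀.1) p₀.2 (EuclideanSpace.single 0 1) 2 ≠ 0)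
    (hm0 : μ p₀.1 (p₀.2 2) ≠ 0) (hm1 : μ p₀.1 (p₀.2 2) ≠ 1) (hmz : deriv (μ p₀.1) (p₀.2 2) ≠ 0)
    (extra pinsX : List QMvPoly)
    (hextra : ∀ T ∈ extra, ∀ p ∈ U, ev L.length T (jetMapOf L u μ A p) = 0)
    (hpinsX : ∀ π ∈ pinsX, ev L.length π (jetMapOf L u μ A p₀) ≠ 0) :
    LocalDatum L.length (tableOf L) (maskOf L) dirVec (thHyps L ++ extra) (thPins L ++ pinsX) := by
  refine ⟨U, p₀, jetMapOf L u μ A, hU, hp₀, fun _ hp => differentiableAt_jetMapOf hu hμ hA hp,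
    fun j i hi _ hp => tables_jetMapOf hU hu hμ hA j i hi hp, ?_, ?_⟩
  · intro T hT p hp
    rcases List.mem_append.1 hT with h | h
    · exact thHyps_vanish hL hU hu hμ hpol hdiv hsh hE T h p hp
    · exact hextra T h p hp
  · intro π hπ
    rcases List.mem_append.1 hπ with h | h
    · exact thPins_ne_zero hL hU hu hμ hp₀ htw hm0 hm1 hmz π h
    · exact hpinsX π h

/-- The final step of a certificate that starts from hand-proved extra laws / pins (tree WITH cancellation nodes). [folklore] -/
theorem false_of_checkTreeC_with (L : List THLetter) (extra Ts pinsX : List QMvPoly) (t : CertTreeC)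
    (ht : checkTreeC L.length (tableOf L) (maskOf L) (thHyps L ++ extra ++ Ts) (thPins L ++ pinsX) t = true)
    (hdat : LocalDatum (E := ℝ × EuclideanSpace ℝ (Fin 3)) L.length (tableOf L) (maskOf L) dirVec
      (thHyps L ++ extra ++ Ts) (thPins L ++ pinsX)) : False :=
  not_localDatum_of_checkTreeC t _ _ ht hdat

/-- The final step of a certificate that starts from hand-proved extra laws / pins (plain v3 tree). [folklore] -/
theorem false_of_checkTreeS_with (L : List THLetter) (extra Ts pinsX : List QMvPoly) (t : CertTree)
    (ht : checkTreeS L.length (tableOf L) (maskOf L) (thHyps L ++ extra ++ Ts) (thPins L ++ pinsX) t = true)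
    (hdat : LocalDatum (E := ℝ × EuclideanSpace ℝ (Fin 3)) L.length (tableOf L) (maskOf L) dirVec
      (thHyps L ++ extra ++ Ts) (thPins L ++ pinsX)) : False :=
  not_localDatum_of_checkTreeS t _ _ ht hdat

end Summit.NavierStokesRegularity.NavierStokesRegularity.Theorems.PoloidalWindowDoorLrcModEntireTHCertExtra

end
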